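import Summits.Ventures.GridStability.Lyapunov.NE39LLffOsoData
import Summits.Ventures.GridStability.Lyapunov.NE39LLffRoa
import Literature.MathematicalPhysics.PowerSystems.LyapunovFunctionFamilyClosedForm
import HarnessLib

/-!
# GridStability/Lyapunov/NE39LLffOsoRoa — LFF P2: the CERTIFICATE OF RECORD «NE39L-λ1/10-h12» as a
# member of the Lyapunov-function family, and its certified synchronisation region

Cell `gridfusion` (LADDER-GRIDFUSION), LFF lane; lead RULING «LFF P2 CERTIFICATE OF RECORD»
2026-08-27T02:35:36Z (Lean ☐ = this file) / successor list 02:51:21Z (3) «lyap-1 (β) NE39LLffOsoRoa»;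
seat gridfusion-lyap-1 (g3); namespace `Summit.Ventures.GridStability.Lyapunov.NE39LLffOso`.
LABEL OF EVERY MENTION: «synthetic VARIANT (conductances dropped, lossless REDISPATCH at the printed
operating angles), not a sentence about the printed New England system»; tokens MV-2L + MV-RD +
MV-λ(1/10) + MV-h12 (MODEL-VALIDITY v0.27).

INPUTS. `Lyapunov/NE39LLffOsoData.lean` (this seat: sos-4's exact `(Q, K, H, eps)` of
`cert/sos-4/j265713/lff-G2V3-NE39Lh12-l10-oso.json` cedb541c3cce88c7, the face identities and two integer
Gram certificates, all `decide`d in the kernel); model-1's object `Models/NE39L.lean` (p486685: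
`NE39L.lffSystemU (1/10)`, `lffSystemU_C_mul_B`, `lffSystemU_obs`, the hypothesis-free bridge
`hasDerivWithinAt_lffState_lines`); lit-6's `Certificate.ofSecondOrder` and
`Certificate.well_subset_regionOfAttraction_of_gap₀` [cite: VuTuritsyn2016, §III eq. (QKH), §IV set ℛ];
the soundness of integer Gram certificates `PSD.IsGramCertZ.posSemidef_of_smul`
[cite: BlekhermanParriloThomas2012, App. A.1.2]; the acute-angle fact `NE39LLff.acute` (p488432).

WHAT IS PROVED. `cert` : the data of record IS a `Certificate (NE39L.lffSystemU (1/10))` (up to the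
definitional unfolding `lffSystemU_eq`): `Q₁₁ᵀ = Q₁₁`, `Q₂₂ᵀ = Q₂₂`, `Q₁₁ + Q₁₂A_d = 0`, `Q₁₂B_a = EᵀH`,
`Q₂₂B_a = EᵀK` (cast from the kernel identities over `ℚ`), `−(Q₁₂ + Q₁₂ᵀ + A_dᵀQ₂₂ + Q₂₂A_d) ⪰ 0` and
`Q − eps·1 ⪰ 0` (integer Gram certificates ⇒ `Matrix.PosSemidef` over `ℝ`, reindexed `Fin 18 ≃ Fin 9 ⊕ Fin 9`),
`eps > 0`, `K ≥ 0`, `H > 0`. `oso_well_subset_regionOfAttraction`: for every level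
`c₀ < V(0) + K_k·vtGap(θ*_k)` (all 45 lines) the set `{x ∈ 𝒫 | V x ≤ c₀}` of `NE39L.lffSystemU (1/10)` is
positively invariant and every global solution from it tends to `0`; `synchronisation_of_isSolutionOn`:
read on the typed classical model `NE39L.data.toModelRel (1/10) a′` — `(δ_m − δ_0) − (θ*_m − θ*_0) → 0`,
`ω_m − ω_0 → 0` for all nine machines. Level SYMBOLIC (explicit rational `c₀`: model-1's
`Models/LineAngleBounds.lean` tables, successor). Companion (solver-free, every λ): `Lyapunov/NE39LLffRoa.lean`.

THREE COLUMNS. CERTIFIED: the membership facts and the two sentences, for MODEL M′. MODELLED: M′ =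
network-reduced classical 10-machine model, lossless redispatched variant, uniform damping ratio `1/10`
(MV-2L + MV-RD + MV-λ(1/10) + MV-h12), reference machine `0` (RULING 13). VALIDATED: the SDP solve that
produced the data (irrelevant to soundness). No sentence of this file says that the New England system or
any grid is stable. Definitions = the real casts of the data and `cert`; no named fact; standard axioms.
-/

noncomputable section

open Set Filter Topology Real Matrix
open Literature.MathematicalPhysics.PowerSystems
open Literature.MathematicalPhysics.PowerSystems.LyapunovFunctionFamily
open Literature.MathematicalPhysics.PowerSystems.ClassicalModel.LosslessSystem (vtGap)
open Literature.Computation.Certificates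
open Summit.Ventures.GridStability.Models

namespace Summit.Ventures.GridStability.Lyapunov.NE39LLffOso

/-! ### The system matrices of `NE39L.lffSystemU (1/10)` (real) -/

/-- `A_d = −λ·1`, `λ = 1/10` (as it appears in `relativeSwing`). -/
def AdR : Matrix (Fin 9) (Fin 9) ℝ := -((((1 / 10 : ℚ)) : ℝ) • (1 : Matrix (Fin 9) (Fin 9) ℝ))

/-- `B_a = (diag(1/M′) + (1/M_0)𝟙𝟙ᵀ)·Eᵀ·diag(w)` (as it appears in `relativeSwing`). -/
def BaR : Matrix (Fin 9) (RecastData.LffLine 9) ℝ :=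
  (Matrix.diagonal (fun i => 1 / (fun m : Fin 9 => ((NE39L.data.M m.succ : ℚ) : ℝ)) i)
      + Matrix.of (fun _ _ => 1 / ((NE39L.data.M 0 : ℚ) : ℝ)))
    * (RecastData.lffEu 9)ᵀ * Matrix.diagonal NE39L.data.lffWu

/-- model-1's system of record IS the second-order structure on these matrices (definitional). -/
theorem lffSystemU_eq : NE39L.lffSystemU (1 / 10) =
    System.secondOrder AdR BaR (RecastData.lffEu 9) (RecastData.lffδsu NE39L.data.angleOf) := rfl

/-! ### The certificate data over `ℝ` -/

/-- `Q` reindexed by `Fin 9 ⊕ Fin 9`, real. -/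
def QsR : Matrix (Fin 9 ⊕ Fin 9) (Fin 9 ⊕ Fin 9) ℝ := Qs.map (Rat.cast : ℚ → ℝ)

/-- Block `Q₁₁`, real. -/
def Q11 : Matrix (Fin 9) (Fin 9) ℝ := Q11q.map (Rat.cast : ℚ → ℝ)

/-- Block `Q₁₂`, real. -/
def Q12 : Matrix (Fin 9) (Fin 9) ℝ := Q12q.map (Rat.cast : ℚ → ℝ)

/-- Block `Q₂₂`, real. -/
def Q22 : Matrix (Fin 9) (Fin 9) ℝ := Q22q.map (Rat.cast : ℚ → ℝ)

/-- Multipliers `H_k`, real. -/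
def H : RecastData.LffLine 9 → ℝ := fun k => (Hq k : ℝ)

/-- Multipliers `K_k`, real. -/
def K : RecastData.LffLine 9 → ℝ := fun k => (Kq k : ℝ)

/-- `eps`, real. -/
def eps : ℝ := (epsQ : ℝ)

/-! ### Cast plumbing (`ℚ → ℝ`, entrywise) -/

/-- `(M·N) ↦ ℝ` = product of the casts (plumbing). -/
private theorem map_mul' {m n o : Type*} [Fintype n] (M : Matrix m n ℚ) (N : Matrix n o ℚ) :
    (M * N).map (Rat.cast : ℚ → ℝ) = M.map (Rat.cast : ℚ → ℝ) * N.map (Rat.cast : ℚ → ℝ) :=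
  Matrix.map_mul (f := Rat.castHom ℝ)

/-- `(M+N) ↦ ℝ` = sum of the casts (plumbing). -/
private theorem map_add' {m n : Type*} (M N : Matrix m n ℚ) :
    (M + N).map (Rat.cast : ℚ → ℝ) = M.map (Rat.cast : ℚ → ℝ) + N.map (Rat.cast : ℚ → ℝ) := by
  ext i j; simp

/-- `(−M) ↦ ℝ` = minus the cast (plumbing). -/
private theorem map_neg' {m n : Type*} (M : Matrix m n ℚ) :
    (-M).map (Rat.cast : ℚ → ℝ) = -M.map (Rat.cast : ℚ → ℝ) := by
  ext i j; simp

/-- Transpose commutes with the cast (plumbing, `rfl`). -/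
private theorem map_transpose' {m n : Type*} (M : Matrix m n ℚ) :
    Mᵀ.map (Rat.cast : ℚ → ℝ) = (M.map (Rat.cast : ℚ → ℝ))ᵀ := rfl

/-- `diag(d) ↦ ℝ = diag(d ↦ ℝ)` (plumbing). -/
private theorem map_diagonal' {n : Type*} [DecidableEq n] (d : n → ℚ) :
    (Matrix.diagonal d).map (Rat.cast : ℚ → ℝ) = Matrix.diagonal (fun i => (d i : ℝ)) :=
  Matrix.diagonal_map Rat.cast_zero

/-- `A_d` is the cast of `Adq`. -/
theorem AdR_eq : AdR = Adq.map (Rat.cast : ℚ → ℝ) := by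
  ext i j
  by_cases h : i = j
  · subst h; simp [AdR, Adq]
  · simp [AdR, Adq, h]

/-- `N` is the cast of `Nq`. -/
theorem N_eq : (Matrix.diagonal (fun i => 1 / (fun m : Fin 9 => ((NE39L.data.M m.succ : ℚ) : ℝ)) i)
      + Matrix.of (fun _ _ => 1 / ((NE39L.data.M 0 : ℚ) : ℝ)) : Matrix (Fin 9) (Fin 9) ℝ)
    = Nq.map (Rat.cast : ℚ → ℝ) := by
  ext i j
  by_cases h : i = j
  · subst h; simp [Nq]
  · simp [Nq, h]

/-- `E` is the cast of `Euq`. -/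
theorem E_eq : RecastData.lffEu 9 = Euq.map (Rat.cast : ℚ → ℝ) := by
  ext k m
  simp only [RecastData.lffEu, RecastData.lffE, Euq, Matrix.map_apply]
  push_cast
  split_ifs <;> simp

/-- `diag(w)` is the cast of `diag(wq)`. -/
theorem W_eq : Matrix.diagonal NE39L.data.lffWu = (Matrix.diagonal wq).map (Rat.cast : ℚ → ℝ) := by
  rw [map_diagonal']; rfl

/-- `B_a` is the cast of `Baq`. -/
theorem BaR_eq : BaR = Baq.map (Rat.cast : ℚ → ℝ) := by
  unfold BaR Baq
  rw [map_mul', map_mul', map_transpose', ← N_eq, ← E_eq, ← W_eq]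

/-! ### The hypotheses of `ofSecondOrder`, discharged -/

/-- `Q₁₁ᵀ = Q₁₁`. -/
theorem h11 : Q11ᵀ = Q11 := by
  show (Q11q.map (Rat.cast : ℚ → ℝ))ᵀ = _
  rw [← map_transpose', Q11q_transpose]; rfl

/-- `Q₂₂ᵀ = Q₂₂`. -/
theorem h22 : Q22ᵀ = Q22 := by
  show (Q22q.map (Rat.cast : ℚ → ℝ))ᵀ = _
  rw [← map_transpose', Q22q_transpose]; rfl

/-- Face identity 1 over `ℝ`: `Q₁₁ + Q₁₂A_d = 0`. -/
theorem h1 : Q11 + Q12 * AdR = 0 := by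
  rw [AdR_eq, Q11, Q12, ← map_mul', ← map_add', face1]
  ext i j; simp

/-- Face identity 2 over `ℝ`: `Q₁₂B_a = EᵀH`. -/
theorem h2 : Q12 * BaR = (RecastData.lffEu 9)ᵀ * Matrix.diagonal H := by
  rw [BaR_eq, Q12, ← map_mul', face2, map_mul', map_transpose', ← E_eq, map_diagonal']
  rfl

/-- Face identity 3 over `ℝ`: `Q₂₂B_a = EᵀK`. -/
theorem h3 : Q22 * BaR = (RecastData.lffEu 9)ᵀ * Matrix.diagonal K := by
  rw [BaR_eq, Q22, ← map_mul', face3, map_mul', map_transpose', ← E_eq, map_diagonal']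
  rfl

/-- The damping matrix `S⁻ = −(Q₁₂ + Q₁₂ᵀ + A_dᵀQ₂₂ + Q₂₂A_d)` over `ℝ` is the cast of `Sq`. -/
theorem S_eq : -(Q12 + Q12ᵀ + AdRᵀ * Q22 + Q22 * AdR) = Sq.map (Rat.cast : ℚ → ℝ) := by
  rw [AdR_eq, Q12, Q22, Sq, map_neg', map_add', map_add', map_add', map_mul', map_mul',
    map_transpose', map_transpose']

/-- **`S⁻ ⪰ 0`** (integer Gram certificate `gram2`, kernel). -/
theorem hS : (-(Q12 + Q12ᵀ + AdRᵀ * Q22 + Q22 * AdR)).PosSemidef := by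
  rw [S_eq]
  exact gram2.posSemidef_of_smul c2_pos gram2_smul

/-- `0 < eps`. -/
theorem hε : 0 < eps := by
  unfold eps; exact_mod_cast epsQ_pos

/-- The block matrix `[[Q₁₁, Q₁₂],[Q₁₂ᵀ, Q₂₂]]` IS `Q` reindexed. -/
theorem fromBlocks_eq : Matrix.fromBlocks Q11 Q12 Q12ᵀ Q22 = QsR := by
  have h21 : Q12ᵀ = Qs.toBlocks₂₁.map (Rat.cast : ℚ → ℝ) := by
    show (Q12q.map (Rat.cast : ℚ → ℝ))ᵀ = _
    rw [← map_transpose', ← Qs_toBlocks₂₁]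
  rw [h21, Q11, Q22, Q12, Q11q, Q12q, Q22q, ← Matrix.fromBlocks_map, Matrix.fromBlocks_toBlocks]
  rfl

/-- `Q − eps·1` (real, reindexed) is the reindexed cast of `P18q`. -/
theorem QsR_sub_eq : QsR - eps • (1 : Matrix (Fin 9 ⊕ Fin 9) (Fin 9 ⊕ Fin 9) ℝ)
    = (P18q.map (Rat.cast : ℚ → ℝ)).submatrix eidx eidx := by
  ext i j
  by_cases h : i = j
  · subst h; simp [QsR, Qs, P18q, eps]
  · have h' : eidx i ≠ eidx j := fun he => h (eidx.injective he)
    simp [QsR, Qs, P18q, eps, h, h']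

/-- **`Q − eps·1 ⪰ 0`** (integer Gram certificate `gram1`, kernel; transported along `Fin 18 ≃ Fin 9 ⊕ Fin 9`). -/
theorem hQε : (Matrix.fromBlocks Q11 Q12 Q12ᵀ Q22
    - eps • (1 : Matrix (Fin 9 ⊕ Fin 9) (Fin 9 ⊕ Fin 9) ℝ)).PosSemidef := by
  rw [fromBlocks_eq, QsR_sub_eq]
  exact (Matrix.posSemidef_submatrix_equiv eidx).2 (gram1.posSemidef_of_smul c1_pos gram1_smul)

/-- `K ≥ 0`. -/
theorem hK : ∀ k, 0 ≤ K k := fun k => by unfold K; exact_mod_cast Kq_nonneg k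

/-- `H > 0`. -/
theorem hH : ∀ k, 0 < H k := fun k => by unfold H; exact_mod_cast Hq_pos k

/-! ### The certificate member of record -/

/-- **LFF P2, certificate of record «NE39L-λ1/10-h12» (sos-4 cedb541c3cce88c7) as a member of the
Lyapunov-function family** for `NE39L.lffSystemU (1/10)` (= the second-order structure, `lffSystemU_eq`):
lit-6's `Certificate.ofSecondOrder` with the exact `(Q₁₁, Q₁₂, Q₂₂, K, H, eps)` and the ten hypotheses
discharged above. CERTIFIED datum; MODELLED column object. [cite: VuTuritsyn2016, §III eq. (QKH)] -/
def cert : Certificate (System.secondOrder AdR BaR (RecastData.lffEu 9)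
    (RecastData.lffδsu NE39L.data.angleOf)) :=
  Certificate.ofSecondOrder AdR BaR (RecastData.lffEu 9) (RecastData.lffδsu NE39L.data.angleOf)
    Q11 Q12 Q22 K H eps h11 h22 h1 h2 h3 hS hε hQε hK hH

/-- Equilibrium line angles inside the polytope on the 45 unordered lines: `|θ*_i − θ*_j| < π/2`
(acute circle points, `NE39LLff.acute`). -/
theorem abs_δsu_lt (k : RecastData.LffLine 9) :
    |RecastData.lffδsu NE39L.data.angleOf k| < π / 2 := by
  show |NE39L.data.angleOf k.1.1 - NE39L.data.angleOf k.1.2| < π / 2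
  have ha := RelativeLff.angleOf_mem_of_acute NE39L.data NE39LLff.acute.1 NE39LLff.acute.2 k.1.1
  have hb := RelativeLff.angleOf_mem_of_acute NE39L.data NE39LLff.acute.1 NE39LLff.acute.2 k.1.2
  rw [abs_lt]; constructor <;> linarith

/-! ### THE CERTIFIED REGION of the certificate of record (symbolic level) -/

/-- **P2: the certified synchronisation region of «NE39L-λ1/10-h12» from the certificate OF RECORD**
([cite: VuTuritsyn2016, §IV set ℛ], gap form `q = 0`). For every level `c₀ < V(0) + K_k·vtGap(θ*_k)` on
all 45 lines `k` and every relative state `y` in the polytope `𝒫` of `NE39L.lffSystemU (1/10)` with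
`V y ≤ c₀`: a global solution of the LFF field exists, and EVERY global solution keeps `{𝒫, V ≤ c₀}` and
tends to `0`. MODELLED: «synthetic lossless redispatched uniform-λ(1/10) variant of the NE39 reduction»
(not a New England sentence). -/
theorem oso_well_subset_regionOfAttraction {c₀ : ℝ}
    (hc₀ : ∀ k, c₀ < cert.V 0 + K k * vtGap (RecastData.lffδsu NE39L.data.angleOf k))
    {y : Fin 9 ⊕ Fin 9 → ℝ} (hy : y ∈ (NE39L.lffSystemU (1 / 10)).polytope) (hyc : cert.V y ≤ c₀) :
    (∃ X : ℝ → Fin 9 ⊕ Fin 9 → ℝ, X 0 = y ∧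
        ∀ T : ℝ, ∀ t ∈ Icc 0 T,
          HasDerivWithinAt X ((NE39L.lffSystemU (1 / 10)).field (X t)) (Icc 0 T) t) ∧
      ∀ X : ℝ → Fin 9 ⊕ Fin 9 → ℝ, X 0 = y →
        (∀ T : ℝ, ∀ t ∈ Icc 0 T,
          HasDerivWithinAt X ((NE39L.lffSystemU (1 / 10)).field (X t)) (Icc 0 T) t) →
        (∀ t, 0 ≤ t → X t ∈ (NE39L.lffSystemU (1 / 10)).polytope ∧ cert.V (X t) ≤ c₀) ∧
          Tendsto X atTop (𝓝 0) := by
  have hCB := NE39L.lffSystemU_C_mul_B (1 / 10)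
  have hobs := NE39L.lffSystemU_obs (1 / 10)
  rw [lffSystemU_eq] at hCB hobs hy ⊢
  exact cert.well_subset_regionOfAttraction_of_gap₀ hCB abs_δsu_lt hobs hc₀ hy hyc

/-- **P2 read on model-1's typed classical model (hypothesis-free).** For every common acceleration
`a′`, every level `c₀` as above and EVERY solution `c` of `NE39L.data.toModelRel (1/10) a′` on `univ`
whose initial relative state `x(0) = ((δ_m − δ_0) − (θ*_m − θ*_0), ω_m − ω_0)_{m=1..9}` lies in the
polytope with `V(x(0)) ≤ c₀`: the relative state keeps `{𝒫, V ≤ c₀}` for all `t ≥ 0` and tends to `0`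
— all nine machines synchronise with the reference machine `0` at the relative angles `θ*`. MODELLED as
above; no sentence here says a grid is stable. [cite: VuTuritsyn2016, §IV set ℛ; SauerPai1998, §6.10] -/
theorem synchronisation_of_isSolutionOn (a : ℝ) {c₀ : ℝ}
    (hc₀ : ∀ k, c₀ < cert.V 0 + K k * vtGap (RecastData.lffδsu NE39L.data.angleOf k))
    {c : ℝ → ClassicalSwing.State 10} (hc : (NE39L.data.toModelRel (1 / 10) a).IsSolutionOn c univ)
    (hy : RecastData.lffState NE39L.data.angleOf (c 0) ∈ (NE39L.lffSystemU (1 / 10)).polytope)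
    (hyc : cert.V (RecastData.lffState NE39L.data.angleOf (c 0)) ≤ c₀) :
    (∀ t, 0 ≤ t →
        RecastData.lffState NE39L.data.angleOf (c t) ∈ (NE39L.lffSystemU (1 / 10)).polytope ∧
          cert.V (RecastData.lffState NE39L.data.angleOf (c t)) ≤ c₀) ∧
      Tendsto (fun t => RecastData.lffState NE39L.data.angleOf (c t)) atTop (𝓝 0) := by
  obtain ⟨-, hall⟩ := oso_well_subset_regionOfAttraction hc₀ hy hyc
  exact hall (fun t => RecastData.lffState NE39L.data.angleOf (c t)) rfl fun T t _ =>
    (NE39L.hasDerivWithinAt_lffState_lines (1 / 10) a hc (mem_univ t)).mono (subset_univ (Icc 0 T))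

end Summit.Ventures.GridStability.Lyapunov.NE39LLffOso

end
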